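/-
Origin: expansion seat `planner-pub-hodgecm-pv07-g3-0`, handover #3 v2 2026-08-18T09:14:30Z (`HOME/pub-hodgecm-pv07-g3/lean/Pv07g3/LocTorusSplitBase.lean`, md5 153b1561, 505 lines);
landed by the gen-7 packager in gate run 27 as `HodgeCM/PerL34/LocTorusSplitBase.lean` (import ^import Pv[0-9]+g[0-9]+\.→import HodgeCM.PerL34. ×1).
-/
/-
HodgeCM / PerL34 publication cell — seam S3 set-up, genuine model, SPLIT finite places: the base completion
(pub-hodgecm-pv07-g3, CLAIM #3 = residual (d2′) of GAPS pv07g3-A1).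
WIP import: `Pv07g3.LocTorusSplit` ↦ `HodgeCM.PerL34.LocTorusSplit` (my HANDOVER #1, run 27); the other import is the
vendored tree module `HodgeCM.Vendored.H21.NumberTheory.Automorphic.AdeleBaseChange` (`adicCompletionOfUnder : K_v →+* L_w`).
Complete proofs, no new axioms, nothing cited.
-/
import Summits.HodgeConjecture.HodgeCM.PerL34.LocTorusSplit_2
import Literature.NumberTheory.Automorphic.AdeleBaseChange

/-!
# A split place of a quadratic extension: `K_v = L_w`, hence `U_v ≃ₜ* K_vˣ`

Residual (d2′) of GAPS pv07g3-A1.  Setting as in `LocTorusSplit`: `L/K` Galois number fields with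
`Aut(L/K) = {1, σ}` (`h2`), `w` a finite place of `L` NOT fixed by `σ` (`σ • w ≠ w`), `v := w ∩ 𝓞 K`.
Then `v` splits in `L`: the fundamental identity `g · e · f = [L:K] = 2` (Mathlib, Galois form
`Ideal.ncard_primesOver_mul_ramificationIdxIn_mul_inertiaDegIn`) with `g ≥ 2` (the distinct primes `w`, `σw`
over `v`) forces `e(w|v) = f(w|v) = 1` (`ramificationIdx_eq_one_and_inertiaDeg_eq_one_of_split`), and
the canonical map of completions `ι := adicCompletionOfUnder (𝓞 K) K L w : K_v →+* L_w` (vendored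
`AdeleBaseChange`, Cassels–Fröhlich II §10) is

* valuation- and norm-preserving (`valued_baseMap`, `norm_baseMap`; `e = 1`, `q_w = q_v`), hence an isometric
  closed embedding (`isometry_baseMap`, `isClosedEmbedding_baseMap`);
* SURJECTIVE (`baseMap_surjective`): `𝓞 K → 𝓞 L ⧸ 𝔭_w ^ N` is onto for every `N` (it is injective on
  `𝓞 K ⧸ 𝔭_v ^ N` by `e = 1`, and `#(𝓞 L ⧸ 𝔭_w^N) = q_w^N = q_v^N = #(𝓞 K ⧸ 𝔭_v^N)` by `f = 1`), so `𝓞 K` is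
  dense in `𝒪_w` (with Mathlib's `exists_valuation_sub_lt_of_integer`: `𝓞 L` is dense in `𝒪_w`), so the closed
  range of `ι` contains `𝒪_w`, and `L_w = ⋃ π^{-M} 𝒪_w` for a `π ∈ 𝔭_v ∖ 0`;

so `ι` is a ring isomorphism AND a homeomorphism (`baseEquiv`, `baseHomeomorph`, `unitsBaseEquiv :
K_vˣ ≃ₜ* L_wˣ`), and the local unitary group at a split place is, to the letter of PerL v5 tex l. 610
("`U(W_i)(L_{0,v})` … is `L_{0,v}^×`" — PerL's `L_0` = the base field = our `K`), **`splitEquivBase : locTorus K L (inr v) ≃ₜ* K_vˣ`**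
(`= unitsBaseEquiv⁻¹ ∘ splitEquiv`), with the level `(Π 𝒪ˣ) ⊓ U_v` corresponding to `𝒪_vˣ`
(`mem_inH_iff_valued_splitEquivBase_eq_one`, `mem_inH_iff_norm_splitEquivBase_eq_one`); §5 the CM forms
`splitEquivBaseCM`, `baseEquivCM` (`K = L⁺`, `σ = c`).  Nothing is cited; every statement is proved from Mathlib
v4.32.0 and landed package modules.
-/

set_option autoImplicit false

noncomputable section

open Topology Filter Set Sum IsDedekindDomain NumberField
open Literature.NumberTheory Literature.NumberTheory.Automorphic
open scoped RestrictedProduct Classical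

namespace HodgeCM.PerL34.IdelicTorusModel

open IdelePlaces RestrictedRegroup RestrictedCutout

variable {K L : Type} [Field K] [Field L] [Algebra K L] [NumberField K] [NumberField L]

omit [NumberField K] [NumberField L] in
/-- The prime of `L` at `w` lies over the prime of `K` at `w ∩ 𝓞 K` (tautological; a LOCAL instance below). -/
theorem liesOver_under (w : HeightOneSpectrum (𝓞 L)) : w.asIdeal.LiesOver (w.under (𝓞 K)).asIdeal := ⟨rfl⟩

/-- A place of a Dedekind domain is a maximal ideal (Mathlib `HeightOneSpectrum.isMaximal`; a LOCAL instance
below). -/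
theorem isMaximal_asIdeal {R : Type*} [CommRing R] [IsDedekindDomain R] (u : HeightOneSpectrum R) :
    u.asIdeal.IsMaximal := u.isMaximal

attribute [local instance] liesOver_under isMaximal_asIdeal

/-! ## §1  `Aut(L/K) = {1, σ}` has two elements; a place moved by `σ` is split: `e = f = 1` -/

section degree

variable (σ : L ≃ₐ[K] L) (h2 : ∀ τ : L ≃ₐ[K] L, τ = 1 ∨ τ = σ)
include h2

omit [NumberField K] [NumberField L] in
/-- `#Aut(L/K) = 2` when `Aut(L/K) = {1, σ}` with `σ ≠ 1`. -/
theorem natCard_gal_of_pair (hσ : σ ≠ 1) : Nat.card (L ≃ₐ[K] L) = 2 :=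
  Nat.card_eq_two_iff.2 ⟨1, σ, hσ.symm, Set.eq_univ_of_forall fun τ => by
    rcases h2 τ with rfl | rfl <;> simp⟩

variable [IsGalois K L] {w : HeightOneSpectrum (𝓞 L)}

/-- **A place moved by `σ` is split**: `e(w | w ∩ K) = 1` and `f(w | w ∩ K) = 1`.  The fundamental identity
in Galois form, `#{primes over v} · e · f = #Aut(L/K) = 2`, with the two distinct primes `w ≠ σ w` over `v`. -/
theorem ramificationIdx_eq_one_and_inertiaDeg_eq_one_of_split (hw : σ • w ≠ w) :
    w.asIdeal.ramificationIdx (𝓞 K) = 1 ∧ w.asIdeal.inertiaDeg (𝓞 K) = 1 := by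
  set p : Ideal (𝓞 K) := (w.under (𝓞 K)).asIdeal with hp
  haveI : (σ • w).asIdeal.LiesOver p :=
    ⟨congrArg HeightOneSpectrum.asIdeal (HeightOneSpectrum.under_algEquiv_smul K L σ w).symm⟩
  have hid := Ideal.ncard_primesOver_mul_ramificationIdxIn_mul_inertiaDegIn p (𝓞 L) (L ≃ₐ[K] L)
  rw [natCard_gal_of_pair σ h2 (ne_one_of_smul_ne σ hw),
    Ideal.ramificationIdxIn_eq_ramificationIdx p w.asIdeal (L ≃ₐ[K] L),
    Ideal.inertiaDegIn_eq_inertiaDeg p w.asIdeal (L ≃ₐ[K] L)] at hid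
  have hne : w.asIdeal ≠ (σ • w).asIdeal := fun h => hw (HeightOneSpectrum.ext h.symm)
  have h2le : 2 ≤ (p.primesOver (𝓞 L)).ncard := by
    have hsub : ({w.asIdeal, (σ • w).asIdeal} : Set (Ideal (𝓞 L))) ⊆ p.primesOver (𝓞 L) := by
      rintro P (rfl | rfl)
      · exact ⟨w.isPrime, inferInstance⟩
      · exact ⟨(σ • w).isPrime, inferInstance⟩
    calc 2 = ({w.asIdeal, (σ • w).asIdeal} : Set (Ideal (𝓞 L))).ncard := (Set.ncard_pair hne).symm
      _ ≤ (p.primesOver (𝓞 L)).ncard := Set.ncard_le_ncard hsub (IsDedekindDomain.primesOver_finite p (𝓞 L))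
  set m := w.asIdeal.ramificationIdx (𝓞 K) * w.asIdeal.inertiaDeg (𝓞 K) with hm
  have hm1 : m = 1 := by
    have hm0 : m ≠ 0 := fun h => by rw [h, mul_zero] at hid; exact absurd hid (by norm_num)
    have hle : m ≤ 1 := by
      by_contra hcon
      have : 2 * 2 ≤ (p.primesOver (𝓞 L)).ncard * m := Nat.mul_le_mul h2le (by omega)
      omega
    omega
  exact mul_eq_one.1 hm1

/-- `e(w | w ∩ K) = 1` at a place moved by `σ` (Mathlib's older `Ideal.ramificationIdx'` form, the one
carried by `valuation_liesOver` / the vendored `valued_adicCompletionOfLiesOver`). -/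
theorem ramificationIdx'_eq_one_of_split (hw : σ • w ≠ w) :
    (w.under (𝓞 K)).asIdeal.ramificationIdx' w.asIdeal = 1 := by
  rw [Ideal.ramificationIdx'_eq_ramificationIdx _ _ (w.under (𝓞 K)).ne_bot]
  exact (ramificationIdx_eq_one_and_inertiaDeg_eq_one_of_split σ h2 hw).1

/-- `f(w | w ∩ K) = 1` at a place moved by `σ` (Mathlib's `Ideal.inertiaDeg'` form). -/
theorem inertiaDeg'_eq_one_of_split (hw : σ • w ≠ w) :
    (w.under (𝓞 K)).asIdeal.inertiaDeg' w.asIdeal = 1 := by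
  rw [Ideal.inertiaDeg'_eq_inertiaDeg]
  exact (ramificationIdx_eq_one_and_inertiaDeg_eq_one_of_split σ h2 hw).2

/-- **Equal residue cardinalities at a split place**: `q_w = #(𝓞 L ⧸ 𝔭_w) = #(𝓞 K ⧸ 𝔭_v) = q_v`. -/
theorem absNorm_eq_of_split (hw : σ • w ≠ w) :
    Ideal.absNorm w.asIdeal = Ideal.absNorm (w.under (𝓞 K)).asIdeal := by
  rw [Ideal.absNorm_eq_pow_inertiaDeg'_of_liesOver w.asIdeal (w.under (𝓞 K)).asIdeal (w.under (𝓞 K)).isPrime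
    (w.under (𝓞 K)).ne_bot, inertiaDeg'_eq_one_of_split σ h2 hw, pow_one]

end degree

/-! ## §2  The map of completions `ι : K_v →+* L_w` at a split place: valuations, norms, closed range -/

section baseMap

variable (K) in
/-- The canonical map of completions `K_{w ∩ K} →+* L_w` (vendored `adicCompletionOfUnder`, the continuous
extension of `K → L`; Cassels–Fröhlich II §10). -/
abbrev baseMap (w : HeightOneSpectrum (𝓞 L)) : (w.under (𝓞 K)).adicCompletion K →+* w.adicCompletion L :=
  adicCompletionOfUnder (𝓞 K) K L w

/-- (Ported verbatim from the HodgeCMPerL package; no docstring in the source.) -/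
@[simp] theorem baseMap_coe (w : HeightOneSpectrum (𝓞 L)) (x : K) :
    baseMap K w (x : (w.under (𝓞 K)).adicCompletion K) = ((algebraMap K L x : L) : w.adicCompletion L) :=
  adicCompletionOfUnder_coe K L w x

/-- (Ported verbatim from the HodgeCMPerL package; no docstring in the source.) -/
theorem continuous_baseMap (w : HeightOneSpectrum (𝓞 L)) : Continuous (baseMap K w) :=
  continuous_adicCompletionOfUnder K L w

variable (σ : L ≃ₐ[K] L) [IsGalois K L] (h2 : ∀ τ : L ≃ₐ[K] L, τ = 1 ∨ τ = σ) {w : HeightOneSpectrum (𝓞 L)}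
  (hw : σ • w ≠ w)
include h2 hw

/-- **`ι` preserves valuations at a split place** (`e = 1`): `v_w(ι y) = v_v(y)`. -/
theorem valued_baseMap (y : (w.under (𝓞 K)).adicCompletion K) : Valued.v (baseMap K w y) = Valued.v y := by
  have h := valued_adicCompletionOfLiesOver K L (w.under (𝓞 K)) w y
  rw [ramificationIdx'_eq_one_of_split σ h2 hw, pow_one] at h
  exact h

omit [IsGalois K L] h2 hw in
/-- (Ported verbatim from the HodgeCMPerL package; no docstring in the source.) -/
private theorem toNNReal_congr_base {e e' : NNReal} (h : e = e') (he : e ≠ 0) (he' : e' ≠ 0) (x : WithZero (Multiplicative ℤ)) :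
    WithZeroMulInt.toNNReal he x = WithZeroMulInt.toNNReal he' x := by
  subst h; rfl

/-- **`ι` preserves norms at a split place** (`e = 1` and `q_w = q_v`): `‖ι y‖ = ‖y‖`. -/
theorem norm_baseMap (y : (w.under (𝓞 K)).adicCompletion K) : ‖baseMap K w y‖ = ‖y‖ := by
  rw [FinitePlace.norm_def, FinitePlace.norm_def, valued_baseMap σ h2 hw]
  have hb : (Ideal.absNorm w.asIdeal : NNReal) = (Ideal.absNorm (w.under (𝓞 K)).asIdeal : NNReal) := by
    exact_mod_cast absNorm_eq_of_split σ h2 hw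
  rw [toNNReal_congr_base hb]

/-- `ι` is an isometry. -/
theorem isometry_baseMap : Isometry (baseMap K w) :=
  AddMonoidHomClass.isometry_of_norm _ (norm_baseMap σ h2 hw)

/-- `ι` is a closed embedding (an isometry out of a complete space). -/
theorem isClosedEmbedding_baseMap : IsClosedEmbedding (baseMap K w) :=
  (isometry_baseMap σ h2 hw).isClosedEmbedding

/-- The range of `ι` is closed in `L_w`. -/
theorem isClosed_range_baseMap : IsClosed (Set.range (baseMap K w)) :=
  (isClosedEmbedding_baseMap σ h2 hw).isClosed_range

end baseMap

/-! ## §3  `𝓞 K` is dense in `𝒪_w` at a split place; `ι` is onto -/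

section dense

variable (σ : L ≃ₐ[K] L) [IsGalois K L] (h2 : ∀ τ : L ≃ₐ[K] L, τ = 1 ∨ τ = σ) {w : HeightOneSpectrum (𝓞 L)}
  (hw : σ • w ≠ w)
include h2 hw

/-- `x ∈ 𝓞 K` lies in `𝔭_w ^ N` iff it lies in `𝔭_v ^ N` (`e = 1`). -/
theorem algebraMap_mem_pow_iff_of_split (x : 𝓞 K) (N : ℕ) :
    algebraMap (𝓞 K) (𝓞 L) x ∈ w.asIdeal ^ N ↔ x ∈ (w.under (𝓞 K)).asIdeal ^ N := by
  rw [← HeightOneSpectrum.intValuation_le_pow_iff_mem, ← HeightOneSpectrum.intValuation_le_pow_iff_mem,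
    ← HeightOneSpectrum.intValuation_liesOver (w.under (𝓞 K)) w x, ramificationIdx'_eq_one_of_split σ h2 hw,
    pow_one]

/-- **`𝓞 K → 𝓞 L ⧸ 𝔭_w ^ N` is onto at a split place**: it is injective on `𝓞 K ⧸ 𝔭_v ^ N` (`e = 1`), and
`#(𝓞 L ⧸ 𝔭_w ^ N) = q_w ^ N = q_v ^ N = #(𝓞 K ⧸ 𝔭_v ^ N)` (`f = 1`). -/
theorem exists_sub_algebraMap_mem_pow_of_split (b : 𝓞 L) (N : ℕ) :
    ∃ k : 𝓞 K, b - algebraMap (𝓞 K) (𝓞 L) k ∈ w.asIdeal ^ N := by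
  set p : Ideal (𝓞 K) := (w.under (𝓞 K)).asIdeal with hp
  have hle : p ^ N ≤ (w.asIdeal ^ N).comap (algebraMap (𝓞 K) (𝓞 L)) := fun x hx =>
    Ideal.mem_comap.2 ((algebraMap_mem_pow_iff_of_split σ h2 hw x N).2 hx)
  have hge : (w.asIdeal ^ N).comap (algebraMap (𝓞 K) (𝓞 L)) ≤ p ^ N := fun x hx =>
    (algebraMap_mem_pow_iff_of_split σ h2 hw x N).1 (Ideal.mem_comap.1 hx)
  have hinj : Function.Injective (Ideal.quotientMap (w.asIdeal ^ N) (algebraMap (𝓞 K) (𝓞 L)) hle) :=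
    Ideal.quotientMap_injective' hge
  haveI : Finite (𝓞 L ⧸ w.asIdeal ^ N) := Ideal.finiteQuotientOfFreeOfNeBot _ (pow_ne_zero N w.ne_bot)
  have hcard : Nat.card (𝓞 L ⧸ w.asIdeal ^ N) ≤ Nat.card (𝓞 K ⧸ p ^ N) := by
    rw [← Submodule.cardQuot_apply, ← Ideal.absNorm_apply, ← Submodule.cardQuot_apply, ← Ideal.absNorm_apply,
      map_pow, map_pow, absNorm_eq_of_split σ h2 hw]
  obtain ⟨q, hq⟩ := (hinj.bijective_of_nat_card_le hcard).2 (Ideal.Quotient.mk (w.asIdeal ^ N) b)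
  obtain ⟨k, rfl⟩ := Ideal.Quotient.mk_surjective q
  refine ⟨k, ?_⟩
  rw [Ideal.quotientMap_mk] at hq
  exact (Ideal.Quotient.mk_eq_mk_iff_sub_mem _ _).1 hq.symm

omit [IsGalois K L] h2 hw in
/-- Norm balls of `L_w` are valuation balls: `‖z‖ < ρ γ ↔ v(z) < γ` for `ρ := toNNReal q_w` (strictly monotone). -/
theorem norm_lt_toNNReal_iff (z : w.adicCompletion L) (γ : WithZero (Multiplicative ℤ)) :
    ‖z‖ < (WithZeroMulInt.toNNReal (NumberField.HeightOneSpectrum.absNorm_ne_zero w) γ : ℝ) ↔ Valued.v z < γ := by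
  rw [FinitePlace.norm_def, NNReal.coe_lt_coe]
  exact (WithZeroMulInt.toNNReal_strictMono (NumberField.HeightOneSpectrum.one_lt_absNorm_nnreal w)).lt_iff_lt

omit [IsGalois K L] h2 hw in
/-- `‖z‖ ≤ ρ γ ↔ v(z) ≤ γ`. -/
theorem norm_le_toNNReal_iff (z : w.adicCompletion L) (γ : WithZero (Multiplicative ℤ)) :
    ‖z‖ ≤ (WithZeroMulInt.toNNReal (NumberField.HeightOneSpectrum.absNorm_ne_zero w) γ : ℝ) ↔ Valued.v z ≤ γ := by
  rw [FinitePlace.norm_def, NNReal.coe_le_coe]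
  exact (WithZeroMulInt.toNNReal_strictMono (NumberField.HeightOneSpectrum.one_lt_absNorm_nnreal w)).le_iff_le

omit [IsGalois K L] h2 hw in
/-- `‖z‖ ≤ 1 ↔ v(z) ≤ 1` on `L_w`. -/
theorem norm_le_one_iff_valued_le_one (z : w.adicCompletion L) : ‖z‖ ≤ 1 ↔ Valued.v z ≤ 1 := by
  rw [FinitePlace.norm_def, ← NNReal.coe_one, NNReal.coe_le_coe]
  exact WithZeroMulInt.toNNReal_le_one_iff (NumberField.HeightOneSpectrum.one_lt_absNorm_nnreal w)

omit [NumberField K] [NumberField L] [IsGalois K L] h2 hw in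
/-- `K → L` restricted to `𝓞 K → 𝓞 L` (definitional). -/
theorem algebraMap_coe_ringOfIntegers (k : 𝓞 K) :
    algebraMap K L (k : K) = ((algebraMap (𝓞 K) (𝓞 L) k : 𝓞 L) : L) := rfl

omit [IsGalois K L] h2 hw in
/-- The image of `k ∈ 𝓞 K` in `L_w` under `ι` is the image of `k ∈ 𝓞 L`. -/
theorem baseMap_coe_ringOfIntegers (k : 𝓞 K) :
    baseMap K w ((k : K) : (w.under (𝓞 K)).adicCompletion K) =
      (((algebraMap (𝓞 K) (𝓞 L) k : 𝓞 L) : L) : w.adicCompletion L) := by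
  rw [baseMap_coe, algebraMap_coe_ringOfIntegers]

omit [IsGalois K L] h2 hw in
/-- Valuation in `L_w` of an element of `𝓞 L`. -/
theorem valued_coe_ringOfIntegers (b : 𝓞 L) : Valued.v (((b : L)) : w.adicCompletion L) = w.intValuation b := by
  rw [HeightOneSpectrum.valuedAdicCompletion_eq_valuation']
  exact HeightOneSpectrum.valuation_of_algebraMap w b

/-- **`𝓞 K` is dense in `𝒪_w` at a split place** (valuation form): every `u ∈ L_w` with `v(u) ≤ 1` is
congruent to some `k ∈ 𝓞 K` modulo `𝔭_w ^ N`, for every `N` — `L` is dense in `L_w` (Mathlib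
`denseRange_algebraMap`), `𝓞 L` is dense in `𝒪_w ∩ L` (Mathlib `exists_valuation_sub_lt_of_integer`), and
`𝓞 K → 𝓞 L ⧸ 𝔭_w ^ N` is onto (`exists_sub_algebraMap_mem_pow_of_split`). -/
theorem exists_valued_sub_baseMap_le_of_split (u : w.adicCompletion L) (hu : Valued.v u ≤ 1) (N : ℕ) :
    ∃ k : 𝓞 K, Valued.v (u - baseMap K w ((k : K) : (w.under (𝓞 K)).adicCompletion K)) ≤
      WithZero.exp (-(N : ℤ)) := by
  set γ : WithZero (Multiplicative ℤ) := WithZero.exp (-(N : ℤ)) with hγ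
  have hγ0 : γ ≠ 0 := WithZero.exp_ne_zero
  have hγ1 : γ ≤ 1 := by
    rw [hγ, ← WithZero.exp_zero]
    exact WithZero.exp_le_exp.2 (by omega)
  -- (1) `l ∈ L` with `v(u - l) < γ`
  obtain ⟨l, hl⟩ : ∃ l : L, Valued.v (u - (l : w.adicCompletion L)) < γ := by
    have hρ : (0 : ℝ) < (WithZeroMulInt.toNNReal (NumberField.HeightOneSpectrum.absNorm_ne_zero w) γ : ℝ) :=
      NNReal.coe_pos.2 (WithZeroMulInt.toNNReal_pos _ hγ0)
    obtain ⟨l, hl⟩ := Metric.denseRange_iff.1 (HeightOneSpectrum.denseRange_algebraMap L w) u _ hρ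
    exact ⟨l, (norm_lt_toNNReal_iff _ γ).1 (by rwa [dist_eq_norm] at hl)⟩
  -- `v(l) ≤ 1`
  have hl1 : w.valuation L l ≤ 1 := by
    rw [← HeightOneSpectrum.valuedAdicCompletion_eq_valuation' w l, show (l : w.adicCompletion L) = u - (u - l) by ring]
    exact (Valuation.map_sub _ _ _).trans (max_le hu (hl.le.trans hγ1))
  -- (2) `b ∈ 𝓞 L` with `v(b - l) < γ`
  obtain ⟨b, hb⟩ := w.exists_valuation_sub_lt_of_integer hl1 (Units.mk0 γ hγ0)
  rw [Units.val_mk0] at hb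
  -- (3) `k ∈ 𝓞 K` with `b - k ∈ 𝔭_w ^ N`
  obtain ⟨k, hk⟩ := exists_sub_algebraMap_mem_pow_of_split σ h2 hw b N
  refine ⟨k, ?_⟩
  have e2 : Valued.v ((l : w.adicCompletion L) - ((b : L) : w.adicCompletion L)) < γ := by
    rw [← Valuation.map_neg, neg_sub, show ((b : L) : w.adicCompletion L) - (l : w.adicCompletion L) =
      (((b : L) - l : L) : w.adicCompletion L) from (map_sub (algebraMap L (w.adicCompletion L)) _ _).symm,
      HeightOneSpectrum.valuedAdicCompletion_eq_valuation']
    exact hb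
  have e3 : Valued.v (((b : L) : w.adicCompletion L) - baseMap K w ((k : K) : (w.under (𝓞 K)).adicCompletion K)) ≤ γ := by
    rw [baseMap_coe_ringOfIntegers, show (((b : L)) : w.adicCompletion L) -
        (((algebraMap (𝓞 K) (𝓞 L) k : 𝓞 L) : L) : w.adicCompletion L) =
        ((((b : L) - ((algebraMap (𝓞 K) (𝓞 L) k : 𝓞 L) : L) : L)) : w.adicCompletion L) from
        (map_sub (algebraMap L (w.adicCompletion L)) _ _).symm,
      show ((b : L) - ((algebraMap (𝓞 K) (𝓞 L) k : 𝓞 L) : L) : L) = ((b - algebraMap (𝓞 K) (𝓞 L) k : 𝓞 L) : L)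
        from (map_sub (algebraMap (𝓞 L) L) _ _).symm,
      valued_coe_ringOfIntegers]
    exact (HeightOneSpectrum.intValuation_le_pow_iff_mem _ _ N).2 hk
  calc Valued.v (u - baseMap K w ((k : K) : (w.under (𝓞 K)).adicCompletion K))
      = Valued.v ((u - l) + (((l : w.adicCompletion L) - ((b : L) : w.adicCompletion L)) +
          (((b : L) : w.adicCompletion L) - baseMap K w ((k : K) : (w.under (𝓞 K)).adicCompletion K)))) := by
        congr 1; ring
    _ ≤ max (Valued.v (u - l)) (max (Valued.v ((l : w.adicCompletion L) - ((b : L) : w.adicCompletion L)))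
          (Valued.v (((b : L) : w.adicCompletion L) -
            baseMap K w ((k : K) : (w.under (𝓞 K)).adicCompletion K)))) :=
        (Valuation.map_add _ _ _).trans (max_le_max le_rfl (Valuation.map_add _ _ _))
    _ ≤ γ := max_le hl.le (max_le e2.le e3)

/-- **`𝒪_w ⊆ ι(K_v)`**: the closed range of the isometry `ι` contains the dense subset `𝓞 K` of `𝒪_w`. -/
theorem mem_range_baseMap_of_valued_le_one (u : w.adicCompletion L) (hu : Valued.v u ≤ 1) :
    u ∈ Set.range (baseMap K w) := by
  rw [← (isClosed_range_baseMap σ h2 hw).closure_eq, Metric.mem_closure_iff]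
  intro ε hε
  set ρ₁ : ℝ := (WithZeroMulInt.toNNReal (NumberField.HeightOneSpectrum.absNorm_ne_zero w)
    (WithZero.exp (-1 : ℤ)) : ℝ) with hρ₁
  have hρ₁1 : ρ₁ < 1 := by
    rw [hρ₁, ← NNReal.coe_one, NNReal.coe_lt_coe,
      WithZeroMulInt.toNNReal_lt_one_iff (NumberField.HeightOneSpectrum.one_lt_absNorm_nnreal w),
      ← WithZero.exp_zero]
    exact WithZero.exp_lt_exp.2 (by norm_num)
  have hρ₁0 : 0 ≤ ρ₁ := NNReal.coe_nonneg _
  obtain ⟨N, hN⟩ := exists_pow_lt_of_lt_one hε hρ₁1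
  obtain ⟨k, hk⟩ := exists_valued_sub_baseMap_le_of_split σ h2 hw u hu N
  refine ⟨_, ⟨((k : K) : (w.under (𝓞 K)).adicCompletion K), rfl⟩, ?_⟩
  rw [dist_eq_norm]
  calc ‖u - baseMap K w ((k : K) : (w.under (𝓞 K)).adicCompletion K)‖
      ≤ (WithZeroMulInt.toNNReal (NumberField.HeightOneSpectrum.absNorm_ne_zero w) (WithZero.exp (-(N : ℤ))) : ℝ) :=
        (norm_le_toNNReal_iff _ _).2 hk
    _ = ρ₁ ^ N := by
        rw [hρ₁, ← NNReal.coe_pow, ← map_pow, ← WithZero.exp_nsmul, smul_neg, nsmul_eq_mul, mul_one]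
    _ < ε := hN

/-- **`ι : K_v →+* L_w` is onto at a split place**: scale any `y ∈ L_w` into `𝒪_w` by a power of
`ι(π)`, `π ∈ 𝔭_v ∖ 0`. -/
theorem baseMap_surjective : Function.Surjective (baseMap K w) := by
  intro y
  -- a nonzero `π ∈ 𝔭_v`, and `c := π ∈ K_v`, `0 < ‖ι c‖ < 1`
  obtain ⟨π, hπ, hπ0⟩ := Submodule.exists_mem_ne_zero_of_ne_bot (w.under (𝓞 K)).ne_bot
  set c : (w.under (𝓞 K)).adicCompletion K := ((π : K) : (w.under (𝓞 K)).adicCompletion K) with hc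
  have hvc : Valued.v c = (w.under (𝓞 K)).intValuation π := by
    rw [hc, HeightOneSpectrum.valuedAdicCompletion_eq_valuation']
    exact HeightOneSpectrum.valuation_of_algebraMap _ π
  have hc1 : ‖baseMap K w c‖ < 1 := by
    rw [norm_baseMap σ h2 hw, FinitePlace.norm_def, ← NNReal.coe_one, NNReal.coe_lt_coe,
      WithZeroMulInt.toNNReal_lt_one_iff (NumberField.HeightOneSpectrum.one_lt_absNorm_nnreal _), hvc]
    exact (HeightOneSpectrum.intValuation_lt_one_iff_mem _ π).2 hπ
  have hc0 : baseMap K w c ≠ 0 := by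
    rw [map_ne_zero]
    intro h
    rw [h, Valuation.map_zero] at hvc
    exact (w.under (𝓞 K)).intValuation_ne_zero π hπ0 hvc.symm
  have hcpos : 0 < ‖baseMap K w c‖ := norm_pos_iff.2 hc0
  -- `M` with `‖ι c‖ ^ M * ‖y‖ ≤ 1`
  obtain ⟨M, hM⟩ := exists_pow_lt_of_lt_one (show (0 : ℝ) < 1 / (‖y‖ + 1) by positivity) hc1
  have hu : Valued.v ((baseMap K w c) ^ M * y) ≤ 1 := by
    rw [← norm_le_one_iff_valued_le_one, norm_mul, norm_pow]
    have hy : 0 ≤ ‖y‖ := norm_nonneg y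
    calc ‖baseMap K w c‖ ^ M * ‖y‖ ≤ 1 / (‖y‖ + 1) * ‖y‖ := by gcongr
      _ ≤ 1 := by rw [div_mul_eq_mul_div, one_mul, div_le_one (by positivity)]; linarith
  obtain ⟨x, hx⟩ := mem_range_baseMap_of_valued_le_one σ h2 hw _ hu
  refine ⟨(c ^ M)⁻¹ * x, ?_⟩
  rw [map_mul, map_inv₀, map_pow, hx, inv_mul_cancel_left₀ (pow_ne_zero M hc0)]

/-- `ι` is bijective at a split place. -/
theorem baseMap_bijective : Function.Bijective (baseMap K w) :=
  ⟨(baseMap K w).injective, baseMap_surjective σ h2 hw⟩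

end dense

/-! ## §4  `K_v = L_w` as topological rings; `U_v ≃ₜ* K_vˣ` with level `𝒪_vˣ` -/

section equivBase

variable (σ : L ≃ₐ[K] L) [IsGalois K L] (h2 : ∀ τ : L ≃ₐ[K] L, τ = 1 ∨ τ = σ) {w : HeightOneSpectrum (𝓞 L)}
  (hw : σ • w ≠ w)
include h2 hw

/-- **`K_v ≃+* L_w` at a split place** (the canonical `ι`, bijective). -/
def baseEquiv : (w.under (𝓞 K)).adicCompletion K ≃+* w.adicCompletion L :=
  RingEquiv.ofBijective (baseMap K w) (baseMap_bijective σ h2 hw)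

/-- (Ported verbatim from the HodgeCMPerL package; no docstring in the source.) -/
@[simp] theorem baseEquiv_apply (y : (w.under (𝓞 K)).adicCompletion K) : baseEquiv σ h2 hw y = baseMap K w y := rfl

/-- (Ported verbatim from the HodgeCMPerL package; no docstring in the source.) -/
theorem baseEquiv_coe (x : K) :
    baseEquiv σ h2 hw (x : (w.under (𝓞 K)).adicCompletion K) = ((algebraMap K L x : L) : w.adicCompletion L) :=
  baseMap_coe w x


-- port_pkg: scope closed for this part
end equivBase
end HodgeCM.PerL34.IdelicTorusModel
end
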